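import Summits.Ventures.Crystal3D.Theorems.StickyWulffConstantCoaxialWallLawTriadicLattice
import Summits.Ventures.Crystal3D.Theorems.StickyWulffConstantGenericWallFloorOffReachCountable
import Summits.Ventures.Crystal3D.Theorems.StickyWulffConstantCoaxialWallLawInPlaneStackWalkers
import HarnessLib

/-!
# The TRIADIC REGISTRY: the registry set of `…OffReach` lies in `A₁·Λ₀[1/3] + A₂·Λ₀[1/3]`, so every pair whose
# relative translation is NOT triadic satisfies the wall floor at `c₀ = 1` — in particular every CO-AXIAL pair with a
# non-triadic offset (crux `CoaxialWallLaw`, stmt-Ventures-19481, line `WallLedgerF`; lane G registry, stmt-Ventures-19480)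

HONEST FRAMING. Venture `Summits/Ventures/Crystal3D` (cell `crystal3d-full`), helper `--supports` the crux
`CoaxialWallLaw` of `route-Ventures-StickyWulffConstant` (REGISTERED line `WallLedgerF`, open stub
`stub_coaxialTwoSlabAdhesion`).  Rung credit only; F-C1 not moved; NOT the stub: `ExactOnly`(C12-55) [E1] and
`StarPairFar` [certified; kernel at computational grade, `StarFar.starPairFar_holds`] stay BY NAME, and the TRIADIC
(registered) offsets — the coherent fault/Shockley cosets and the two-partial cosets `⅓·slot` — remain the crux's census.

THE THEOREM.  Lane G (19480-p2, `…WalkReach`/`…StackLedgerOffReach`/`…OffReach`/`…OffReachCountable`) proved the crux's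
matrix `GenericWallFloorAt A₁ t₁ A₂ t₂` (`c₀ = 1`, ARBITRARY fillings, modulo E1/StarPairFar) whenever `t₂ − t₁` lies off
the REGISTRY SET `registrySet A₁ A₂ (chainFrames e₃ A₁ u₁) (chainFrames (−e₃) A₂ u₂)` of a steep slot pair — a countable set
described only implicitly (slot vectors of all forced-ray frames).  Here it is made ARITHMETIC:
1. `nextNormal_unit_menu` — along a forced ray every entry normal is a unit `{111}` menu normal of its own frame
   (`menu_mirror_slot`: the mirror `2√(2/3)·Gδ − ν` of a menu normal through a positive slot is a menu normal; the
   degenerate `bestCapper = 0` branch gives `−ν`), so (`forcedTop_frame_triadic`) EVERY forced-ray frame over a frame `A`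
   mapping `Λ₀` into `A₁·Λ₀[1/3]` does so too (`triadicLattice_twin`: each `{111}` mirror divides by at most `3`);
2. `reachGroup_chainFrames_le_triadic` — hence `reachGroup (chainFrames z A u) ⊆ A₁·Λ₀[1/3]`, and
   **`registrySet_chainFrames_subset_triadic`** — for `A₂` mapping `Λ₀` into `A₁·Λ₀[1/3]` (every CO-AXIAL partner,
   `triadicLattice_of_coaxial`; every `Σ3ⁿ` chain partner) the whole registry set lies in `A₁·Λ₀[1/3]`;
3. **`genericWallFloorAt_of_not_triadic`** — `t₂ − t₁ ∉ A₁·Λ₀[1/3]` ⇒ `¬RegisteredAt` ⇒ `GenericWallFloorAt A₁ t₁ A₂ t₂`;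
   `twoSlabLedgerAt_one_of_not_triadic` — lane G's per-pair ledger `TwoSlabLedgerAt 1` likewise.
   The CO-AXIAL corollaries (crux data `hco`, height form along any `{111}` normal, half-layer offsets, lane F's stub
   conclusion verbatim) are in the sequel `…CoaxialWallLawTriadicRegistryCoaxial`.
READING (planner's A86.8, F side).  The registered co-axial offsets are the TRIADIC ones: `A₁⁻¹(t₂ − t₁) ∈ Λ₀[1/3]`
(cubic coordinates `(a,b,c)/√2` with `a, b, c ∈ ℤ[1/3]`, `a+b+c` even) — the fault/Shockley-partial cosets
(`(1,1,−2)/6 = ⅓·(½,½,−1)`) and the «two-partial» cosets `⅓·slot` (INCOHERENT: the grains never touch) are in; the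
octahedral/tetrahedral HOLE cosets (class (A): odd resp. half-odd coordinate sums ⇒ height `(ℤ+½)·d₀` resp. `(ℤ±¼)·d₀`
along `(1,1,1)`), every half-layer offset (`T*`), and every offset with an irrational coordinate are OUT, i.e. FREE at
`c₀ = 1 ≥ ½ sin θ` for arbitrary fillings.  The converse inclusion is strict (`Λ₀[1/3]` is only an upper bound for the reach
group), so «registered» ⊆ «triadic».
WHAT THIS IS NOT: not the stub (triadic offsets open: the census); no countability or measure statement; F-C1 not moved.
-/

noncomputable section

namespace Summit.Ventures.Crystal3D.Theorems

open Summit.Ventures.Crystal3D Finset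
open Literature.MathematicalPhysics.StatisticalMechanics (fccStacking barlowStacking IsHaggSeq contactDeficiency)
open scoped InnerProductSpace

/-! ### The mirror of a menu normal through a positive slot -/

/-- **The second `{111}` normal through a slot.**  If `ν` is a unit menu normal of `G` and `δ` a slot with
`⟪G δ, ν⟫ = √(2/3)`, then `2√(2/3)·G δ − ν` is again a menu normal of `G`. -/
theorem menu_mirror_slot (G : EuclideanSpace ℝ (Fin 3) ≃ₗᵢ[ℝ] EuclideanSpace ℝ (Fin 3)) {ν δ : EuclideanSpace ℝ (Fin 3)}
    (hmenu : ∀ w ∈ fccSlots, ⟪G w, ν⟫_ℝ = 0 ∨ ⟪G w, ν⟫_ℝ = Real.sqrt (2 / 3) ∨ ⟪G w, ν⟫_ℝ = -Real.sqrt (2 / 3))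
    (hδ : δ ∈ fccSlots) (hpos : ⟪G δ, ν⟫_ℝ = Real.sqrt (2 / 3)) :
    ∀ w ∈ fccSlots, ⟪G w, (2 * Real.sqrt (2 / 3)) • G δ - ν⟫_ℝ = 0 ∨
      ⟪G w, (2 * Real.sqrt (2 / 3)) • G δ - ν⟫_ℝ = Real.sqrt (2 / 3) ∨
      ⟪G w, (2 * Real.sqrt (2 / 3)) • G δ - ν⟫_ℝ = -Real.sqrt (2 / 3) := by
  intro w hw
  have hr : 0 < Real.sqrt (2 / 3) := Real.sqrt_pos.2 (by norm_num)
  have hw1 : ‖w‖ = 1 := norm_eq_one_of_mem_fccSlots hw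
  have hδ1 : ‖δ‖ = 1 := norm_eq_one_of_mem_fccSlots hδ
  have e : ⟪G w, (2 * Real.sqrt (2 / 3)) • G δ - ν⟫_ℝ = 2 * Real.sqrt (2 / 3) * ⟪w, δ⟫_ℝ - ⟪G w, ν⟫_ℝ := by
    rw [inner_sub_right, inner_smul_right, LinearIsometryEquiv.inner_map_map]
  rw [e]
  rcases inner_slots_mem hw hδ with h | h | h | h | h
  · -- `w = δ`
    have hwδ : w = δ := (inner_eq_one_iff_of_norm_eq_one hw1 hδ1).1 h
    subst hwδ
    rw [h, hpos]; right; left; ring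
  · -- `⟪w, δ⟫ = ½`: `w − δ` is a slot
    have hsub := hmenu _ (sub_mem_fccSlots_of_inner_eq_half hw hδ h)
    rw [map_sub, inner_sub_left, hpos] at hsub
    rw [h]
    rcases hmenu w hw with h' | h' | h' <;> rw [h'] at hsub ⊢
    · right; left; ring
    · left; ring
    · exfalso; rcases hsub with h'' | h'' | h'' <;> linarith
  · -- `⟪w, δ⟫ = 0`
    rw [h]
    rcases hmenu w hw with h' | h' | h' <;> rw [h']
    · left; ring
    · right; right; ring
    · right; left; ring
  · -- `⟪w, δ⟫ = −½`: `w + δ` is a slot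
    have hδ' := neg_mem_fccSlots hδ
    have h' : ⟪w, -δ⟫_ℝ = 1 / 2 := by rw [inner_neg_right, h]; ring
    have hadd := hmenu _ (sub_mem_fccSlots_of_inner_eq_half hw hδ' h')
    rw [sub_neg_eq_add, map_add, inner_add_left, hpos] at hadd
    rw [h]
    rcases hmenu w hw with h'' | h'' | h'' <;> rw [h''] at hadd ⊢
    · right; right; ring
    · exfalso; rcases hadd with h₃ | h₃ | h₃ <;> linarith
    · left; ring
  · -- `w = −δ`
    have hsum : w + δ = 0 := by
      have h0 : ‖w + δ‖ ^ 2 = 0 := by rw [norm_add_sq_real, hw1, hδ1, h]; ring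
      exact norm_eq_zero.1 (by nlinarith [norm_nonneg (w + δ)])
    have hwδ : w = -δ := eq_neg_of_add_eq_zero_left hsum
    subst hwδ
    have hneg : ⟪G (-δ), ν⟫_ℝ = -Real.sqrt (2 / 3) := by rw [map_neg, inner_neg_left, hpos]
    rw [h, hneg]; right; right; ring

/-- The mirrored normal is a unit vector. -/
theorem norm_mirror_slot (G : EuclideanSpace ℝ (Fin 3) ≃ₗᵢ[ℝ] EuclideanSpace ℝ (Fin 3)) {ν δ : EuclideanSpace ℝ (Fin 3)}
    (hν : ‖ν‖ = 1) (hδ : δ ∈ fccSlots) (hpos : ⟪G δ, ν⟫_ℝ = Real.sqrt (2 / 3)) :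
    ‖(2 * Real.sqrt (2 / 3)) • G δ - ν‖ = 1 := by
  have hc : ‖G δ‖ = 1 := by rw [LinearIsometryEquiv.norm_map, norm_eq_one_of_mem_fccSlots hδ]
  have h23 : Real.sqrt (2 / 3) * Real.sqrt (2 / 3) = 2 / 3 := Real.mul_self_sqrt (by norm_num)
  have hsq : ‖(2 * Real.sqrt (2 / 3)) • G δ - ν‖ ^ 2 = 1 := by
    rw [norm_sub_sq_real, norm_smul, hc, mul_one, inner_smul_left, hpos, hν, Real.norm_eq_abs,
      abs_of_nonneg (by positivity)]
    simp only [RCLike.conj_to_real]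
    nlinarith [h23]
  exact (pow_eq_one_iff_of_nonneg (norm_nonneg _) two_ne_zero).1 hsq

/-! ### Along a forced ray every entry normal is a unit menu normal of its frame -/

/-- The direction of a ray entry is the best capper of its own frame and normal. -/
theorem forcedTop_dir (z : EuclideanSpace ℝ (Fin 3)) (b : WalkEntry) (n : EuclideanSpace ℝ (Fin 3)) (k : ℕ) :
    (forcedTop z b n k).dir = bestCapper (forcedTop z b n k).frame (forcedTop z b n k).nrm z := by
  cases k <;> rfl

/-- **The forced next normal is a unit menu normal of the same frame** — for ANY entry whose direction is the best
capper of its frame and (unit, menu) normal: through a positive slot by `menu_mirror_slot`, and `−ν` in the degenerate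
branch `bestCapper = 0`. -/
theorem nextNormal_unit_menu {z : EuclideanSpace ℝ (Fin 3)} {e : WalkEntry}
    (hdir : e.dir = bestCapper e.frame e.nrm z) (hν : ‖e.nrm‖ = 1)
    (hmenu : ∀ w ∈ fccSlots, ⟪e.frame w, e.nrm⟫_ℝ = 0 ∨ ⟪e.frame w, e.nrm⟫_ℝ = Real.sqrt (2 / 3) ∨
      ⟪e.frame w, e.nrm⟫_ℝ = -Real.sqrt (2 / 3)) :
    ‖nextNormal e‖ = 1 ∧
      ∀ w ∈ fccSlots, ⟪e.frame w, nextNormal e⟫_ℝ = 0 ∨ ⟪e.frame w, nextNormal e⟫_ℝ = Real.sqrt (2 / 3) ∨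
        ⟪e.frame w, nextNormal e⟫_ℝ = -Real.sqrt (2 / 3) := by
  classical
  have hr : 0 < Real.sqrt (2 / 3) := Real.sqrt_pos.2 (by norm_num)
  by_cases hne : (fccSlots.filter fun q => 0 < ⟪e.frame q, e.nrm⟫_ℝ).Nonempty
  · obtain ⟨hmem, -⟩ := bestCapper_spec e.frame e.nrm z hne
    rw [← hdir, Finset.mem_filter] at hmem
    obtain ⟨hd, hdpos⟩ := hmem
    have hpos : ⟪e.frame e.dir, e.nrm⟫_ℝ = Real.sqrt (2 / 3) := by
      rcases hmenu e.dir hd with h | h | h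
      · rw [h] at hdpos; exact absurd hdpos (lt_irrefl 0)
      · exact h
      · rw [h] at hdpos; linarith
    exact ⟨norm_mirror_slot e.frame hν hd hpos, menu_mirror_slot e.frame hmenu hd hpos⟩
  · have h0 : e.dir = 0 := by rw [hdir]; unfold bestCapper; rw [dif_neg hne]
    have hN : nextNormal e = -e.nrm := by rw [nextNormal, h0, map_zero, smul_zero, zero_sub]
    rw [hN, norm_neg]
    refine ⟨hν, fun w hw => ?_⟩
    rw [inner_neg_right]
    rcases hmenu w hw with h | h | h
    · left; rw [h, neg_zero]
    · right; right; rw [h]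
    · right; left; rw [h, neg_neg]

/-- **Every forced-ray frame maps `Λ₀` into the triadic module of `A₁`** (with its entry normal a unit menu normal of it),
provided the base frame `A` does and the first push normal `n` is a unit menu normal of `A`. -/
theorem forcedTop_frame_triadic (z : EuclideanSpace ℝ (Fin 3))
    (A : EuclideanSpace ℝ (Fin 3) ≃ₗᵢ[ℝ] EuclideanSpace ℝ (Fin 3)) (u : EuclideanSpace ℝ (Fin 3))
    {n : EuclideanSpace ℝ (Fin 3)} (hn : ‖n‖ = 1)
    (hmenu : ∀ w ∈ fccSlots, ⟪A w, n⟫_ℝ = 0 ∨ ⟪A w, n⟫_ℝ = Real.sqrt (2 / 3) ∨ ⟪A w, n⟫_ℝ = -Real.sqrt (2 / 3))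
    (A₁ : EuclideanSpace ℝ (Fin 3) ≃ₗᵢ[ℝ] EuclideanSpace ℝ (Fin 3))
    (hA : ∀ x ∈ fccStacking 1 (Real.sqrt (2 / 3)),
      ∃ j : ℕ, ((3 : ℝ) ^ j) • A₁.symm (A x) ∈ fccStacking 1 (Real.sqrt (2 / 3))) (k : ℕ) :
    ‖(forcedTop z ⟨A, u, 0⟩ n k).nrm‖ = 1 ∧
    (∀ w ∈ fccSlots, ⟪(forcedTop z ⟨A, u, 0⟩ n k).frame w, (forcedTop z ⟨A, u, 0⟩ n k).nrm⟫_ℝ = 0 ∨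
      ⟪(forcedTop z ⟨A, u, 0⟩ n k).frame w, (forcedTop z ⟨A, u, 0⟩ n k).nrm⟫_ℝ = Real.sqrt (2 / 3) ∨
      ⟪(forcedTop z ⟨A, u, 0⟩ n k).frame w, (forcedTop z ⟨A, u, 0⟩ n k).nrm⟫_ℝ = -Real.sqrt (2 / 3)) ∧
    ∀ x ∈ fccStacking 1 (Real.sqrt (2 / 3)),
      ∃ j : ℕ, ((3 : ℝ) ^ j) • A₁.symm ((forcedTop z ⟨A, u, 0⟩ n k).frame x) ∈ fccStacking 1 (Real.sqrt (2 / 3)) := by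
  induction k with
  | zero =>
    refine ⟨hn, ?_, ?_⟩
    · exact menu_reflect A (twinFrame A n) hn hmenu (twinFrame_apply A hn)
    · exact triadicLattice_twin hA hn hmenu
  | succ k ih =>
    obtain ⟨hν, hmenuk, htri⟩ := ih
    obtain ⟨hN, hmenuN⟩ := nextNormal_unit_menu (forcedTop_dir z ⟨A, u, 0⟩ n k) hν hmenuk
    refine ⟨hN, ?_, ?_⟩
    · exact menu_reflect _ (twinFrame _ _) hN hmenuN (twinFrame_apply _ hN)
    · exact triadicLattice_twin htri hN hmenuN

/-! ### The reach group and the registry set are triadic -/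

/-- Every chain frame over `A` maps `Λ₀` into the triadic module of `A₁` (if `A` does). -/
theorem chainFrames_triadic {z : EuclideanSpace ℝ (Fin 3)} {A : EuclideanSpace ℝ (Fin 3) ≃ₗᵢ[ℝ] EuclideanSpace ℝ (Fin 3)}
    {u : EuclideanSpace ℝ (Fin 3)} {A₁ : EuclideanSpace ℝ (Fin 3) ≃ₗᵢ[ℝ] EuclideanSpace ℝ (Fin 3)}
    (hA : ∀ x ∈ fccStacking 1 (Real.sqrt (2 / 3)),
      ∃ j : ℕ, ((3 : ℝ) ^ j) • A₁.symm (A x) ∈ fccStacking 1 (Real.sqrt (2 / 3)))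
    {F : EuclideanSpace ℝ (Fin 3) ≃ₗᵢ[ℝ] EuclideanSpace ℝ (Fin 3)} (hF : F ∈ chainFrames z A u) :
    ∀ x ∈ fccStacking 1 (Real.sqrt (2 / 3)),
      ∃ j : ℕ, ((3 : ℝ) ^ j) • A₁.symm (F x) ∈ fccStacking 1 (Real.sqrt (2 / 3)) := by
  rcases hF with rfl | ⟨n, hn, hmenu, -, k, rfl⟩
  · exact hA
  · exact (forcedTop_frame_triadic z A u hn hmenu A₁ hA k).2.2

/-- **The reach group is triadic**: `reachGroup (chainFrames z A u) ⊆ A₁·Λ₀[1/3]` whenever `A·Λ₀ ⊆ A₁·Λ₀[1/3]`. -/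
theorem reachGroup_chainFrames_le_triadic {z : EuclideanSpace ℝ (Fin 3)}
    {A : EuclideanSpace ℝ (Fin 3) ≃ₗᵢ[ℝ] EuclideanSpace ℝ (Fin 3)} {u : EuclideanSpace ℝ (Fin 3)}
    {A₁ : EuclideanSpace ℝ (Fin 3) ≃ₗᵢ[ℝ] EuclideanSpace ℝ (Fin 3)}
    (hA : ∀ x ∈ fccStacking 1 (Real.sqrt (2 / 3)),
      ∃ j : ℕ, ((3 : ℝ) ^ j) • A₁.symm (A x) ∈ fccStacking 1 (Real.sqrt (2 / 3)))
    {v : EuclideanSpace ℝ (Fin 3)} (hv : v ∈ reachGroup (chainFrames z A u)) :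
    ∃ j : ℕ, ((3 : ℝ) ^ j) • A₁.symm v ∈ fccStacking 1 (Real.sqrt (2 / 3)) := by
  unfold reachGroup at hv
  induction hv using AddSubgroup.closure_induction with
  | mem v hv =>
    obtain ⟨F, hF, w, hw, rfl⟩ := hv
    exact chainFrames_triadic hA hF w (mem_fcc_of_mem_fccSlots hw)
  | zero => exact ⟨0, by rw [map_zero, smul_zero]; exact zero_mem_fccLattice⟩
  | add v w _ _ hv hw => exact triadicVec_add hv hw
  | neg v _ hv => exact triadicVec_neg hv

/-- **The registry set is triadic.**  For any frame `A₂` mapping `Λ₀` into `A₁·Λ₀[1/3]` (every co-axial partner, every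
`Σ3ⁿ` chain partner) and any verticals/steep slots, `registrySet A₁ A₂ (chainFrames z₁ A₁ u₁) (chainFrames z₂ A₂ u₂)`
lies in `A₁·Λ₀[1/3]`. -/
theorem registrySet_chainFrames_subset_triadic
    {A₁ A₂ : EuclideanSpace ℝ (Fin 3) ≃ₗᵢ[ℝ] EuclideanSpace ℝ (Fin 3)}
    (hA₂ : ∀ x ∈ fccStacking 1 (Real.sqrt (2 / 3)),
      ∃ j : ℕ, ((3 : ℝ) ^ j) • A₁.symm (A₂ x) ∈ fccStacking 1 (Real.sqrt (2 / 3)))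
    {z₁ z₂ u₁ u₂ : EuclideanSpace ℝ (Fin 3)} {d : EuclideanSpace ℝ (Fin 3)}
    (hd : d ∈ registrySet A₁ A₂ (chainFrames z₁ A₁ u₁) (chainFrames z₂ A₂ u₂)) :
    ∃ j : ℕ, ((3 : ℝ) ^ j) • A₁.symm d ∈ fccStacking 1 (Real.sqrt (2 / 3)) := by
  obtain ⟨x₁, hx₁, x₂, hx₂, v₁, hv₁, v₂, hv₂, rfl⟩ := hd
  exact triadicVec_sub (triadicVec_add (triadicVec_sub (triadicVec_of_mem A₁ hx₁) (hA₂ x₂ hx₂))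
    (reachGroup_chainFrames_le_triadic (triadicLattice_self A₁) hv₁)) (reachGroup_chainFrames_le_triadic hA₂ hv₂)

/-- **General two-frame form**: for ANY frames the registry set lies in `A₁·Λ₀[1/3] + A₂·Λ₀[1/3]`. -/
theorem registrySet_chainFrames_subset_triadic_add
    (A₁ A₂ : EuclideanSpace ℝ (Fin 3) ≃ₗᵢ[ℝ] EuclideanSpace ℝ (Fin 3))
    {z₁ z₂ u₁ u₂ : EuclideanSpace ℝ (Fin 3)} {d : EuclideanSpace ℝ (Fin 3)}
    (hd : d ∈ registrySet A₁ A₂ (chainFrames z₁ A₁ u₁) (chainFrames z₂ A₂ u₂)) :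
    ∃ d₁ d₂ : EuclideanSpace ℝ (Fin 3), d = d₁ - d₂ ∧
      (∃ j : ℕ, ((3 : ℝ) ^ j) • A₁.symm d₁ ∈ fccStacking 1 (Real.sqrt (2 / 3))) ∧
      (∃ j : ℕ, ((3 : ℝ) ^ j) • A₂.symm d₂ ∈ fccStacking 1 (Real.sqrt (2 / 3))) := by
  obtain ⟨x₁, hx₁, x₂, hx₂, v₁, hv₁, v₂, hv₂, rfl⟩ := hd
  refine ⟨A₁ x₁ + v₁, A₂ x₂ + v₂, by abel, ?_, ?_⟩
  · exact triadicVec_add (triadicVec_of_mem A₁ hx₁) (reachGroup_chainFrames_le_triadic (triadicLattice_self A₁) hv₁)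
  · exact triadicVec_add (triadicVec_of_mem A₂ hx₂) (reachGroup_chainFrames_le_triadic (triadicLattice_self A₂) hv₂)

/-! ### Non-triadic offsets are unregistered, hence free at `c₀ = 1` -/

/-- **A non-triadic relative translation is unregistered.** -/
theorem not_registeredAt_of_not_triadic
    {A₁ : EuclideanSpace ℝ (Fin 3) ≃ₗᵢ[ℝ] EuclideanSpace ℝ (Fin 3)} {t₁ : EuclideanSpace ℝ (Fin 3)}
    {A₂ : EuclideanSpace ℝ (Fin 3) ≃ₗᵢ[ℝ] EuclideanSpace ℝ (Fin 3)} {t₂ : EuclideanSpace ℝ (Fin 3)}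
    (hA₂ : ∀ x ∈ fccStacking 1 (Real.sqrt (2 / 3)),
      ∃ j : ℕ, ((3 : ℝ) ^ j) • A₁.symm (A₂ x) ∈ fccStacking 1 (Real.sqrt (2 / 3)))
    (ht : ¬ ∃ j : ℕ, ((3 : ℝ) ^ j) • A₁.symm (t₂ - t₁) ∈ fccStacking 1 (Real.sqrt (2 / 3))) :
    ¬ RegisteredAt A₁ t₁ A₂ t₂ := by
  intro hreg
  obtain ⟨u₁, hu₁, hsteep₁⟩ := exists_steep_slot_up A₁
  obtain ⟨u₂, hu₂, hsteep₂⟩ := exists_steep_slot_down A₂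
  exact ht (registrySet_chainFrames_subset_triadic hA₂
    (sub_mem_registrySet_of_registeredAt hreg hu₁ hsteep₁ hu₂ hsteep₂))

open scoped Classical in
/-- **The wall floor for every pair with a NON-TRIADIC relative translation** (`c₀ = 1`, arbitrary fillings, modulo
`ExactOnly`(C12-55) and `StarPairFar`): any frame `A₂` mapping `Λ₀` into `A₁·Λ₀[1/3]`, any `t₁, t₂` with
`3^j · A₁⁻¹(t₂ − t₁) ∉ Λ₀` for every `j`. -/
theorem genericWallFloorAt_of_not_triadic
    {s₀ : EuclideanSpace ℝ (Fin 3)} (hs₀ : s₀ ∈ fccSlots)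
    (hcert : ExactOnly 0 (fccSlots.filter fun w => 0 < ⟪w, s₀⟫_ℝ)) (hfar : StarPairFar)
    {A₁ : EuclideanSpace ℝ (Fin 3) ≃ₗᵢ[ℝ] EuclideanSpace ℝ (Fin 3)} {t₁ : EuclideanSpace ℝ (Fin 3)}
    {A₂ : EuclideanSpace ℝ (Fin 3) ≃ₗᵢ[ℝ] EuclideanSpace ℝ (Fin 3)} {t₂ : EuclideanSpace ℝ (Fin 3)}
    (hA₂ : ∀ x ∈ fccStacking 1 (Real.sqrt (2 / 3)),
      ∃ j : ℕ, ((3 : ℝ) ^ j) • A₁.symm (A₂ x) ∈ fccStacking 1 (Real.sqrt (2 / 3)))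
    (ht : ¬ ∃ j : ℕ, ((3 : ℝ) ^ j) • A₁.symm (t₂ - t₁) ∈ fccStacking 1 (Real.sqrt (2 / 3))) :
    GenericWallFloorAt A₁ t₁ A₂ t₂ :=
  genericWallFloorAt_of_not_registeredAt hs₀ hcert hfar (not_registeredAt_of_not_triadic hA₂ ht)

open scoped Classical in
/-- **Lane G's per-pair ledger at charge `1` for every pair with a non-triadic relative translation** (arbitrary
fillings, modulo `ExactOnly`(C12-55) and `StarPairFar`). -/
theorem twoSlabLedgerAt_one_of_not_triadic
    {s₀ : EuclideanSpace ℝ (Fin 3)} (hs₀ : s₀ ∈ fccSlots)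
    (hcert : ExactOnly 0 (fccSlots.filter fun w => 0 < ⟪w, s₀⟫_ℝ)) (hfar : StarPairFar)
    {A₁ : EuclideanSpace ℝ (Fin 3) ≃ₗᵢ[ℝ] EuclideanSpace ℝ (Fin 3)} {t₁ : EuclideanSpace ℝ (Fin 3)}
    {A₂ : EuclideanSpace ℝ (Fin 3) ≃ₗᵢ[ℝ] EuclideanSpace ℝ (Fin 3)} {t₂ : EuclideanSpace ℝ (Fin 3)}
    (hA₂ : ∀ x ∈ fccStacking 1 (Real.sqrt (2 / 3)),
      ∃ j : ℕ, ((3 : ℝ) ^ j) • A₁.symm (A₂ x) ∈ fccStacking 1 (Real.sqrt (2 / 3)))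
    (ht : ¬ ∃ j : ℕ, ((3 : ℝ) ^ j) • A₁.symm (t₂ - t₁) ∈ fccStacking 1 (Real.sqrt (2 / 3))) :
    TwoSlabLedgerAt 1 A₁ t₁ A₂ t₂ := by
  obtain ⟨u₁, hu₁, hsteep₁⟩ := exists_steep_slot_up A₁
  obtain ⟨u₂, hu₂, hsteep₂⟩ := exists_steep_slot_down A₂
  have hoff : t₂ - t₁ ∉ registrySet A₁ A₂ (chainFrames (EuclideanSpace.single (2 : Fin 3) (1 : ℝ)) A₁ u₁)
      (chainFrames (-EuclideanSpace.single (2 : Fin 3) (1 : ℝ)) A₂ u₂) :=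
    fun hmem => ht (registrySet_chainFrames_subset_triadic hA₂ hmem)
  have h := twoSlabLedgerAt_offReach hs₀ hcert hfar A₁ t₁ A₂ t₂ hu₁ hsteep₁ hu₂ hsteep₂ _ _
    (fun _ hS hW hlast => frame_mem_chainFrames_of_stack hS hW hlast)
    (fun _ hS hW hlast => frame_mem_chainFrames_of_stack hS hW hlast)
    (reachSet_disjoint_of_not_mem_registrySet hoff)
  refine twoSlabLedgerAt_mono ?_ h
  have hκ₁ := one_le_flux_of_steep (A := A₁) (u := u₁) (le_trans hsteep₁ (le_abs_self _))
  have hκ₂ : 1 ≤ Real.sqrt 2 * |⟪A₂ u₂, EuclideanSpace.single (2 : Fin 3) (1 : ℝ)⟫_ℝ| := by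
    refine one_le_flux_of_steep (A := A₂) (u := u₂) ?_
    rw [abs_of_nonpos (by linarith only [hsteep₂, Real.sqrt_nonneg 2] :
      ⟪A₂ u₂, EuclideanSpace.single (2 : Fin 3) (1 : ℝ)⟫_ℝ ≤ 0)]
    linarith only [hsteep₂]
  linarith only [hκ₁, hκ₂]

end Summit.Ventures.Crystal3D.Theorems

end
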